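import Summits.ResolutionOfSingularities.ResolutionOfSingularities.Theorems.MarkedTransferCampaignW22UniformContactDimThreeNegative
import Mathlib.Algebra.Ring.GeomSum
import HarnessLib

/-!
# [OURS · L1 W2.2] THE GRID WITNESS against «uniform A1» in ambient dimension 3 for EVERY prime `p` (degenerate head):
# frame, permissibility and order of the head `(X₁X₂^{p−1})^p + ε`, `g = (X₁^p − X₀^{2p−2}X₁)(X₂^p − X₀^{2p−2}X₂)^{p−1}`

Cell `res-hironaka`, rung L of LADDER-RESOLUTION, RESCUE-SEED slot W2.2 «other cleaning operators» (group L-G2); host item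
`MarkedTransfer.MarkedOrderReductionP` (stmt-15520) as `--supports` helper. Proof file (theorems only): the WITNESS DATA used by the
companion file `MarkedTransferCampaignW22UniformContactDimThreeNegativeAllP.lean` to refute, for EVERY prime `p`, the rows
`UniformContactDim p N` / `UniformlySafeOperatorDim p N` (`N ≥ 3`) of res-L1-type-o3's `MarkedTransferCampaignW22UniformContactDim.lean`
(p499805) AS TYPED (degenerate heads allowed). Written by res-type-055 gen 8 (reserve volunteer; generalises the four-parabolas
witness of `…W22UniformContactDimThreeNegative.lean`, p506784, from `p = 2` to all `p`).

HONEST FRAMING. Everything here is OURS (a campaign computation); NOTHING here is a statement of H. Hironaka's manuscript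
*Resolution of singularities in positive characteristics* (2017-03-23, [Hironaka2017], lit key `paper:url-3343fd9e678b`) or of any
cited paper, and nothing here asserts or denies any statement of those texts. AI mathematics; weaker than expert review.

THE WITNESS (any field `K` of characteristic `p`, `p` prime; `K⟦X₀,X₁,X₂⟧`). Put `U := X₁^p − X₀^{2(p−1)}X₁`,
`V := X₂^p − X₀^{2(p−1)}X₂` — under `X₀² ↦ T` these are `∏_{c ∈ 𝔽_p}(X₁ − cT)` and `∏_{c ∈ 𝔽_p}(X₂ − cT)` — and
`g := U·V^{p−1}`, `y := X₁X₂^{p−1}` (a DEGENERATE head variable, `ord y = p ≥ 2`), `ε := g − y^p`, head `e = 1` (`q = p`):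
* `isRegularSystemOfParameters_gridFrame` — `(X₁ − aX₀², X₂ − bX₀², X₀)` is a regular system of parameters (all `a b : K`);
* `gridU_mem_span` / `gridV_mem_span` — for `a` with `a^p = a` (i.e. `a ∈ 𝔽_p ⊂ K`), `U ∈ (X₁ − aX₀²)`, `V ∈ (X₂ − bX₀²)`
  (`X₁^p − (aX₀²)^p = (X₁ − aX₀²)·(…)` and `a^p = a`);
* `grid_head_mem_pow` — PERMISSIBILITY: `g ∈ P_{ab}^p` for the `p²` coordinate curves `P_{ab} = (X₁ − aX₀², X₂ − bX₀²)`,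
  `a, b ∈ 𝔽_p` (parabolas `T ↦ (T, aT², bT²)`): `g = U·V^{p−1} ∈ P·P^{p−1}`;
* `grid_eps_mem_pow` — `ε = g − y^p ∈ 𝔪^{p²+1}` (indeed `ord ε = p² + p − 1`), so the head condition `p < ord ε` holds
  (`grid_head_condition`) and T1 at this head forces `Y − y ∈ 𝔪^{p+1}` (companion file).
The plane-curve picture: with `T = X₀²`, `g` is the homogenisation of `h(x,y) = (x^p − x)(y^p − y)^{p−1}`, a plane curve of
degree `p²` over `𝔽_p` with multiplicity `p` at EVERY rational point and top form `(x y^{p−1})^p`.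

## References
* H. Hironaka, *Resolution of singularities in positive characteristics*, manuscript 2017-03-23 (lit key `paper:url-3343fd9e678b`):
  p.84 l.38–42, p.85 l.3, Prop. 9.1 (2) p.47 l.7, Th. 9.18 (1) p.55 l.49–51 — ROLES only (dictionary T1/T2/A1). [Hironaka2017]
  [claim: Hironaka2017, status: under-review]
* Cell files: tree `…W22UniformContactDim.lean` (p499805), `…W22UniformContactDimThreeNegative.lean` (p506784, the `p = 2` instance
  `y = X₁² + X₁X₂ + X₂²` of the same mechanism); session search scripts `search/plane2.py` (res-type-055); STATUS res-type-055 2026-08-27.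
-/

set_option linter.dupNamespace false -- mandated namespace of this single-conjunct summit

noncomputable section

namespace Summit.ResolutionOfSingularities.ResolutionOfSingularities.Theorems

namespace CampaignW22

open Literature.AlgebraicGeometry.Resolution
open Literature.AlgebraicGeometry.Hironaka2017.S06BaseHike
open IsLocalRing
open MvPowerSeries (X C)

section Frame

variable (K : Type) [Field K]

/-- [OURS · L1 W2.2] replaces the role of an allowable coordinate change (Def. 6.8 p.32) for the witness; NOT a statement of the
manuscript. THE FRAME OF THE PARABOLA `T ↦ (T, aT², bT²)`: `(X₁ − aX₀², X₂ − bX₀², X₀)` is a regular system of parameters of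
`K⟦X₀,X₁,X₂⟧` for all `a b : K` (the frame of `…W22UniformContactDimThreeNegative.lean` at `(−a, −b)`). [folklore] -/
theorem isRegularSystemOfParameters_gridFrame [IsRegularLocalRing (MvPowerSeries (Fin 3) K)] (a b : K) :
    IsRegularSystemOfParameters
      (![X 1 - C a * X 0 ^ 2, X 2 - C b * X 0 ^ 2, X 0] : Fin 3 → MvPowerSeries (Fin 3) K) := by
  have h := isRegularSystemOfParameters_fourParabolasFrame K (-a) (-b)
  have e : (![X 1 - C a * X 0 ^ 2, X 2 - C b * X 0 ^ 2, X 0] : Fin 3 → MvPowerSeries (Fin 3) K) =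
      ![X 1 + C (-a) * X 0 ^ 2, X 2 + C (-b) * X 0 ^ 2, X 0] := by
    funext i
    fin_cases i
    · show (X 1 - C a * X 0 ^ 2 : MvPowerSeries (Fin 3) K) = X 1 + C (-a) * X 0 ^ 2
      rw [map_neg]; ring
    · show (X 2 - C b * X 0 ^ 2 : MvPowerSeries (Fin 3) K) = X 2 + C (-b) * X 0 ^ 2
      rw [map_neg]; ring
    · rfl
  rw [e]
  exact h

end Frame

section Witness

variable (p : ℕ) [Fact p.Prime] (K : Type) [Field K]

/-- [OURS · L1 W2.2] plumbing for the witness (no manuscript content): for `a ∈ K` with `a^p = a` (an element of the prime field),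
`U = X₁^p − X₀^{2(p−1)}X₁` lies in `(X₁ − aX₀²)` — `U = (X₁^p − (aX₀²)^p) − X₀^{2(p−1)}(X₁ − aX₀²)`. Any field. [folklore] -/
theorem gridU_mem_span (a : K) (ha : a ^ p = a) :
    (X 1 ^ p - X 0 ^ (2 * (p - 1)) * X 1 : MvPowerSeries (Fin 3) K) ∈
      Ideal.span ({X 1 - C a * X 0 ^ 2} : Set (MvPowerSeries (Fin 3) K)) := by
  have hp1 : 1 ≤ p := (Fact.out : p.Prime).one_lt.le
  have h2 : (C a * X 0 ^ 2 : MvPowerSeries (Fin 3) K) ^ p = C a * X 0 ^ (2 * (p - 1)) * X 0 ^ 2 := by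
    rw [mul_pow, ← map_pow, ha, ← pow_mul, mul_assoc, ← pow_add]
    congr 2
    omega
  have h3 : (X 1 ^ p - X 0 ^ (2 * (p - 1)) * X 1 : MvPowerSeries (Fin 3) K) =
      (X 1 ^ p - (C a * X 0 ^ 2) ^ p) + (-(X 0 ^ (2 * (p - 1)))) * (X 1 - C a * X 0 ^ 2) := by
    rw [h2]; ring
  rw [Ideal.mem_span_singleton, h3]
  exact dvd_add (sub_dvd_pow_sub_pow _ _ p) (dvd_mul_left _ _)

/-- [OURS · L1 W2.2] plumbing for the witness (no manuscript content): for `b ∈ K` with `b^p = b`, `V = X₂^p − X₀^{2(p−1)}X₂` lies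
in `(X₂ − bX₀²)`. Any field. [folklore] -/
theorem gridV_mem_span (b : K) (hb : b ^ p = b) :
    (X 2 ^ p - X 0 ^ (2 * (p - 1)) * X 2 : MvPowerSeries (Fin 3) K) ∈
      Ideal.span ({X 2 - C b * X 0 ^ 2} : Set (MvPowerSeries (Fin 3) K)) := by
  have hp1 : 1 ≤ p := (Fact.out : p.Prime).one_lt.le
  have h2 : (C b * X 0 ^ 2 : MvPowerSeries (Fin 3) K) ^ p = C b * X 0 ^ (2 * (p - 1)) * X 0 ^ 2 := by
    rw [mul_pow, ← map_pow, hb, ← pow_mul, mul_assoc, ← pow_add]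
    congr 2
    omega
  have h3 : (X 2 ^ p - X 0 ^ (2 * (p - 1)) * X 2 : MvPowerSeries (Fin 3) K) =
      (X 2 ^ p - (C b * X 0 ^ 2) ^ p) + (-(X 0 ^ (2 * (p - 1)))) * (X 2 - C b * X 0 ^ 2) := by
    rw [h2]; ring
  rw [Ideal.mem_span_singleton, h3]
  exact dvd_add (sub_dvd_pow_sub_pow _ _ p) (dvd_mul_left _ _)

/-- [OURS · L1 W2.2] replaces the role of «center D ⊂ ∇, permissible» (p.85 l.3; `ord_D g ≥ q`) for the witness; NOT a statement
of the manuscript. PERMISSIBILITY OF THE `p²` PARABOLAS: for `a, b ∈ K` with `a^p = a`, `b^p = b`,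
`g = U·V^{p−1} ∈ P_{ab}^p`, `P_{ab} = (X₁ − aX₀², X₂ − bX₀²)` (`U ∈ P_{ab}`, `V ∈ P_{ab}`). Any field. [folklore] -/
theorem grid_head_mem_pow (a b : K) (ha : a ^ p = a) (hb : b ^ p = b) :
    ((X 1 ^ p - X 0 ^ (2 * (p - 1)) * X 1) * (X 2 ^ p - X 0 ^ (2 * (p - 1)) * X 2) ^ (p - 1) :
        MvPowerSeries (Fin 3) K) ∈
      Ideal.span ({X 1 - C a * X 0 ^ 2, X 2 - C b * X 0 ^ 2} : Set (MvPowerSeries (Fin 3) K)) ^ p := by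
  have hp1 : 1 ≤ p := (Fact.out : p.Prime).one_lt.le
  set P : Ideal (MvPowerSeries (Fin 3) K) := Ideal.span {X 1 - C a * X 0 ^ 2, X 2 - C b * X 0 ^ 2} with hP
  have hU : (X 1 ^ p - X 0 ^ (2 * (p - 1)) * X 1 : MvPowerSeries (Fin 3) K) ∈ P :=
    Ideal.span_mono (Set.singleton_subset_iff.mpr (Set.mem_insert _ _)) (gridU_mem_span p K a ha)
  have hV : (X 2 ^ p - X 0 ^ (2 * (p - 1)) * X 2 : MvPowerSeries (Fin 3) K) ∈ P :=
    Ideal.span_mono (Set.singleton_subset_iff.mpr (Set.mem_insert_of_mem _ (Set.mem_singleton _)))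
      (gridV_mem_span p K b hb)
  have h := Ideal.mul_mem_mul hU (Ideal.pow_mem_pow hV (p - 1))
  have hPp : P * P ^ (p - 1) = P ^ p := by
    rw [← pow_succ', Nat.sub_add_cancel hp1]
  rwa [hPp] at h

/-- [OURS · L1 W2.2] the head condition of the schemas in the strong form used by T1 (`ord ε > q`, Eq. (129) p.84 l.38 — ROLE only;
NOT a statement of the manuscript): `ε = U·V^{p−1} − (X₁X₂^{p−1})^p ∈ 𝔪^{p²+1}` (`V^{p−1} − X₂^{p(p−1)} ∈ 𝔪^{p(p−2)+(2p−1)}` by the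
geometric-sum factorisation, `U − X₁^p = −X₀^{2(p−1)}X₁ ∈ 𝔪^{2p−1}`). Any field. [folklore] -/
theorem grid_eps_mem_pow :
    ((X 1 ^ p - X 0 ^ (2 * (p - 1)) * X 1) * (X 2 ^ p - X 0 ^ (2 * (p - 1)) * X 2) ^ (p - 1)
        - (X 1 * X 2 ^ (p - 1)) ^ p : MvPowerSeries (Fin 3) K) ∈
      maximalIdeal (MvPowerSeries (Fin 3) K) ^ (p * p + 1) := by
  obtain ⟨r, hr⟩ : ∃ r, p = r + 2 := ⟨p - 2, by have := (Fact.out : p.Prime).two_le; omega⟩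
  subst hr
  have hX : ∀ i : Fin 3, (X i : MvPowerSeries (Fin 3) K) ∈ maximalIdeal _ := X_mem_maximalIdeal K (Fin 3)
  have hpow : ∀ (i : Fin 3) (k : ℕ), (X i ^ k : MvPowerSeries (Fin 3) K) ∈ maximalIdeal _ ^ k :=
    fun i k => Ideal.pow_mem_pow (hX i) k
  set M : Ideal (MvPowerSeries (Fin 3) K) := maximalIdeal (MvPowerSeries (Fin 3) K) with hM
  -- the pieces and their orders (all exponents written for `p = r + 2`)
  have e1 : 2 * (r + 2 - 1) = 2 * r + 2 := by omega
  have e2 : r + 2 - 1 = r + 1 := by omega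
  rw [e1, e2]
  set U : MvPowerSeries (Fin 3) K := X 1 ^ (r + 2) - X 0 ^ (2 * r + 2) * X 1 with hU
  set V : MvPowerSeries (Fin 3) K := X 2 ^ (r + 2) - X 0 ^ (2 * r + 2) * X 2 with hV
  set B : MvPowerSeries (Fin 3) K := X 2 ^ (r + 2) with hB
  have hX1 : X 0 ^ (2 * r + 2) * X 1 ∈ M ^ (2 * r + 3) := by
    have h := Ideal.mul_mem_mul (hpow 0 (2 * r + 2)) (hX 1)
    rwa [← pow_succ] at h
  have hX2 : X 0 ^ (2 * r + 2) * X 2 ∈ M ^ (2 * r + 3) := by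
    have h := Ideal.mul_mem_mul (hpow 0 (2 * r + 2)) (hX 2)
    rwa [← pow_succ] at h
  have hUm : U ∈ M ^ (r + 2) :=
    sub_mem (hpow 1 _) (Ideal.pow_le_pow_right (by omega) hX1)
  have hVm : V ∈ M ^ (r + 2) :=
    sub_mem (hpow 2 _) (Ideal.pow_le_pow_right (by omega) hX2)
  have hBm : B ∈ M ^ (r + 2) := hpow 2 _
  have hVB : V - B ∈ M ^ (2 * r + 3) := by
    have h1 : V - B = -(X 0 ^ (2 * r + 2) * X 2) := by rw [hV, hB]; ring
    rw [h1]
    exact neg_mem hX2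
  have hUX : U - X 1 ^ (r + 2) ∈ M ^ (2 * r + 3) := by
    have h1 : U - X 1 ^ (r + 2) = -(X 0 ^ (2 * r + 2) * X 1) := by rw [hU]; ring
    rw [h1]
    exact neg_mem hX1
  -- `V^{r+1} − B^{r+1} ∈ M^{(r+2) r + (2r+3)}` by the geometric-sum factorisation
  have hgeom : V ^ (r + 1) - B ^ (r + 1) ∈ M ^ ((r + 2) * r + (2 * r + 3)) := by
    rw [← geom_sum₂_mul V B (r + 1), pow_add]
    refine Ideal.mul_mem_mul ?_ hVB
    refine Ideal.sum_mem _ fun i hi => ?_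
    have hi' : i ≤ r := by
      have := Finset.mem_range.mp hi
      omega
    have h := Ideal.mul_mem_mul (Ideal.pow_mem_pow hVm i) (Ideal.pow_mem_pow hBm (r + 1 - 1 - i))
    rw [← pow_mul, ← pow_mul, ← pow_add] at h
    have heq : (r + 2) * i + (r + 2) * (r + 1 - 1 - i) = (r + 2) * r := by
      rw [← mul_add]
      congr 1
      omega
    rwa [heq] at h
  -- assemble: `ε = U (V^{r+1} − B^{r+1}) + (U − X₁^{r+2}) B^{r+1}`
  have hsplit : U * V ^ (r + 1) - (X 1 * X 2 ^ (r + 1)) ^ (r + 2) =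
      U * (V ^ (r + 1) - B ^ (r + 1)) + (U - X 1 ^ (r + 2)) * B ^ (r + 1) := by
    rw [hB, mul_pow, ← pow_mul, ← pow_mul, Nat.mul_comm (r + 1) (r + 2)]
    ring
  rw [hsplit]
  refine add_mem ?_ ?_
  · have h := Ideal.mul_mem_mul hUm hgeom
    rw [← pow_add] at h
    refine Ideal.pow_le_pow_right ?_ h
    calc (r + 2) * (r + 2) + 1 ≤ (r + 2) * (r + 2) + 1 + r := Nat.le_add_right _ _
      _ = r + 2 + ((r + 2) * r + (2 * r + 3)) := by ring
  · have h := Ideal.mul_mem_mul hUX (Ideal.pow_mem_pow hBm (r + 1))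
    rw [← pow_mul, ← pow_add] at h
    refine Ideal.pow_le_pow_right ?_ h
    calc (r + 2) * (r + 2) + 1 ≤ (r + 2) * (r + 2) + 1 + r := Nat.le_add_right _ _
      _ = 2 * r + 3 + (r + 2) * (r + 1) := by ring

/-- [OURS · L1 W2.2] the head condition `ord ε > p^e` (Eq. (129) p.84 l.38 — ROLE only; NOT a statement of the manuscript) for the
grid witness head (`e = 1`): `p^1 < ord ε` (indeed `ε ∈ 𝔪^{p²+1}`). Any field. [folklore] -/
theorem grid_head_condition :
    ((p ^ 1 : ℕ) : ℕ∞) < adicOrder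
      (((X 1 ^ p - X 0 ^ (2 * (p - 1)) * X 1) * (X 2 ^ p - X 0 ^ (2 * (p - 1)) * X 2) ^ (p - 1)
        - (X 1 * X 2 ^ (p - 1)) ^ p : MvPowerSeries (Fin 3) K)) := by
  have h := (le_adicOrder_iff _ (p * p + 1)).mpr (grid_eps_mem_pow p K)
  refine lt_of_lt_of_le ?_ h
  have hp1 : 1 ≤ p := (Fact.out : p.Prime).one_lt.le
  have : p ^ 1 < p * p + 1 := by
    rw [pow_one]
    nlinarith
  exact_mod_cast this

end Witness

end CampaignW22

end Summit.ResolutionOfSingularities.ResolutionOfSingularities.Theorems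

end
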